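import Summits.SmoothPoincare4.SmoothPoincare4.Theses.SymplecticOrigami
import Summits.SmoothPoincare4.SmoothPoincare4.Theses.SymplecticCap
import Summits.SmoothPoincare4.SmoothPoincare4.Theses.SchoenfliesSplit
import Summits.SmoothPoincare4.SmoothPoincare4.Theorems.OrigamiRung.Negative.GenusTable
import Literature.AlgebraicTopology.SingularHomology.SingularChains
import Literature.Topology.FourManifolds.TwistedSpheres
import Literature.Topology.FourManifolds.CerfGammaFour
import Literature.Topology.FourManifolds.HomotopyS4CompactProofs
import Literature.Geometry.Symplectic.GromovR4RelEnd

/-!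
# Skeleton line `rank-one-integrality-pinch` for crux `OrigamiRung` (stmt-SmoothPoincare4-7843)

Route `SymplecticOrigami`, crux r3 `OrigamiRung` (the RUNG: a smooth homotopy 4-sphere `M` that is a
symplectic fold `M = V̄₀ ∪_Z V̄₁`, each closed side blown down by `βᵢ` onto a closed symplectic
`(Nᵢ, sᵢ)` collapsing `Z` onto a symplectic surface `Bᵢ = bᵢ(Sᵢ)`, is `S⁴` — or both pieces are
doors `(b₁, b₂)(Nᵢ) = (2, 1)`).  Idea card `Ideas/rank-one-integrality-pinch.md` (crux-ideate r1 k1;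
triage r1-1/2/3: PASS ×3, merged with `torus-meridian-pinch` ≈ `adjunction-doubling-sieve` into the
"SW-free integral pinch"; sharpenings adopted below).

THE LINE.  Once the pieces have `b₂(Nᵢ) = 1`, classes are INTEGERS in the rank-one lattice
`H₂(Nᵢ)/Tors = ℤh`, `h² = +1`: `[Bᵢ] = mᵢ h`, `c₁(Nᵢ) = kᵢ h`.  Two integrality facts replace the
route card's `b⁺ = 1` Seiberg–Witten inputs (Liu 1996 A/B, Taubes SW = Gr, Li–Liu, Gromov isotopy):
(T) the two meridians (order `mᵢ`, Thom sequence) sit in `Tors H₁(Z) ≅ ℤ/m²`, which is CYCLIC, so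
`m = 1` (`meridian_pinch`, kernel-checked); (A) adjunction `2g − 2 = m² − k m` and
`k² = c₁² = 2χ + 3σ = 9 − 4b₁` then give `b₁(Nᵢ) = g(3 − g)` on both sides, and the pinch
`b₁(N₀) + b₁(N₁) = 2g` leaves `g ∈ {0, 2}` (`sieve`, kernel-checked).  `g = 2` is the door disjunct
verbatim (tightness `Negative.door_is_solution` respected); `g = 0` hands the endgame two symplectic
`(+1)`-SPHERES with contractible complements (`e = 1` exported, triage sharpen), closed by symplectic
recognition (Gromov rel. end, IN TREE and shared BY NAME with route SymplecticCap's crux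
`GromovRecognitionRelEnd` = stmt-11009; McDuff/Wendl pair theorem as the alternative engine) and
Cerf's `Γ₄ = 0` (shared BY NAME with route SchoenfliesSplit's item `SchsplitCerf` = stmt-8758).

REGISTERED STUBS (4) — each a classical package, stated over tree declarations + the bundle
`FoldData` (= the crux's two hypothesis clauses verbatim, as in `SketchIdeator3.lean`) and the one
local notion `meridianOrder N B := |ker (H₁(N ∖ B) → H₁(N))|`:
* `stub_bettiPinch`   [S2a, rational pinch]  `∃ g, b₁(Sᵢ) = 2g ∧ b₂(Nᵢ) = 1 (both i),
  b₁(Z) = 2g, b₁(N₀) + b₁(N₁) = 2g` — Mayer–Vietoris in the homology sphere, χ-count, Thom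
  ranks, `[sᵢ]² > 0`, `[Bᵢ]·[sᵢ] > 0`, and the almost-complex parity `χ + σ ≡ 0 (4)` killing the
  Euler-number-zero branch (Disproof `no_isotropic_pinch`).  Uses NO blow-down clause.
* `stub_torsionPinch` [S2b, integral pinch = lever (T)'s topological half]  given `b₂(Nᵢ) = 1`:
  `0 < mᵢ`, `|Tors H₁(Z)| = mᵢ²` (both i), `Tors H₁(Z)` cyclic, `ℤ/m₀ ⊕ ℤ/m₁ ↪ Tors H₁(Z)`; and
  the genus-0 export: `b₁(Sᵢ) = 0 ∧ mᵢ = 1 ⇒ Vᵢ` simply connected with `H̃_*(Vᵢ) = 0`.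
  Integral MV iso `H₁(Z) ≅ H₁(V̄₀) ⊕ H₁(V̄₁)`, Thom/Gysin with `e = Bᵢ² = mᵢ²`, unimodularity,
  van Kampen.  Uses NO blow-down clause (triage r1-1 mutation note: `Z ~ S(νBᵢ)` is a homology
  cobordism even without corank 1).
* `stub_chernPackage`  [S4, the one classical CHERN package, per closed symplectic `(N, s)` with
  `b₂ = 1` and a symplectic surface `b : S ↪ N`]  `∃ k, k² = 9 − 4 b₁(N) ∧ b₁(S) − 2 = m² − k m`
  (`m = meridianOrder`): `c₁` of an `s`-tame `J`, `c₁² = 2χ + 3σ` (Hirzebruch + Wu), adjunction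
  equality for `J`-holomorphic `B`, `⟨+1⟩` lattice.  NO Seiberg–Witten.
* `stub_genusZeroEndgame` [S6, HARDEST]  `gromov_recognitionR4_relEnd →` (genus-0 export) `⇒
  ∃ φ, IsTwistedSphere 3 φ M`: `Sᵢ ≅ S²` (orientable + `b₁ = 0`), `Bᵢ² = +1` (`mᵢ = 1`),
  symplectic neighbourhood theorem ⇒ the end of `(Vᵢ, βᵢ* sᵢ)` is the outer shell of `B⁴`,
  cap/stretch to a form standard at infinity, `π₂ = 0` from the export, Gromov rel. end ⇒
  `Vᵢ ∪ collar ≅ D⁴`; the COLLAR LEMMA (corank-1 clause used HERE and only here: Hadamard on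
  `w ∘ βᵢ`, rank `3 = 2 + 1`; cards round-tube-pullback-collar / corank-one-collar, Disproof §4
  `collarLemmaSketch`) identifies that compactification with `V̄ᵢ ⊂ M`; two balls meeting along
  `Z ≅ S³` ⇒ twisted sphere.  Alternative engine E1 (card pair-rigidity-endgame): Wendl 2018
  Thm D(2) = McDuff 1990 on the pair `(Nᵢ, Bᵢ)`; a prover using E1 ignores the Gromov antecedent.

`OrigamiRung_of` composes the four stubs with the two SHARED obligations taken BY NAME
(`SymplecticCap.GromovRecognitionRelEnd`, `SchoenfliesSplit.SchsplitCerf` — tagged route items,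
admissible hypotheses of the skeleton audit; no new debt is created for them here) into the crux
BY NAME; the algebra between the stubs (`meridian_pinch`, `sieve`) is PROVED here, so the line's
claim "no gauge theory in the rung" is itself kernel-checked: everything non-classical sits in the
two named deep theorems, both already filed elsewhere.

Disproof used (`Cruxes/OrigamiRung/Disproof.lean`, cdisprove, read 2026-08-16): §1–2
(`origamiRung_of_smoothPoincare4`, `strongestRung_iff_smoothPoincare4`): no `_false_without_H`
theorem exists or can exist short of an exotic `S⁴`, so stubs are judged on method; accordingly no
stub concludes an `M`-only statement except the endgame, whose conclusion is the STRUCTURAL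
`IsTwistedSphere` (two embedded balls), not `M ≅ S⁴`.  §3: `bettiPinch`/`no_isotropic_pinch` are the
arithmetic shadow of `stub_bettiPinch`; `genusTable` is superseded (its Liu-A hypothesis `aᵢ ∈ {0,2}`
and free `m ∈ {1,2}` are removed by (A) and (T)); `door_is_solution` RESPECTED (door branch kept —
`example` below); `conic_case_excluded` is the `m = 2` instance of `meridian_pinch` (`example`
below).  §4: `mutationNotes` (frontier `Vᵢ = Z` automatic, fold connectedness redundant) and
`collarLemmaSketch` (corank 1 pins the collar) are used in `stub_genusZeroEndgame` only.  Landed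
Negative lemmas imported: `Theorems/OrigamiRung/Negative/GenusTable.lean` (p73229); no stub is an
instance of anything refuted (negatives index for SmoothPoincare4: empty).  Refuted-in-spirit
strengthening avoided: "the lift `β̃ᵢ : V̄ᵢ → Bl_{Bᵢ} Nᵢ` is a diffeomorphism" (FALSE as typed,
triage r1-2/3 counter-model) is stubbed nowhere; only the level-set collar is used.
-/

noncomputable section

-- the prescribed namespace `Summit.<P>.<Sub>.…` duplicates `SmoothPoincare4` (P = Sub)
set_option linter.dupNamespace false

open scoped Manifold ContDiff Topology ContinuousMap
open Set Function TopologicalSpace CategoryTheory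
open Literature.Topology.FourManifolds (singularHomologyZ IsTwistedSphere TwistedSphere)
open Summit.SmoothPoincare4.SmoothPoincare4.Theses.SymplecticOrigami (OrigamiRung)

namespace Summit.SmoothPoincare4.SmoothPoincare4.Cruxes.OrigamiRung.RankOneIntegralityPinch

/-- Model space `ℝⁿ`. -/
local notation "𝔼" n:arg => EuclideanSpace ℝ (Fin n)
/-- The round 4-sphere. -/
local notation "𝕊⁴" => (Metric.sphere (0 : EuclideanSpace ℝ (Fin 5)) 1)
/-- The round 3-sphere. -/
local notation "𝕊³" => (Metric.sphere (0 : EuclideanSpace ℝ (Fin 4)) 1)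

/-! ### Vocabulary (two local notions; everything else is tree vocabulary) -/

/-- The fold data of `OrigamiRung` (its two hypothesis clauses, verbatim, as one predicate; same text
as `Cruxes/OrigamiRung/SketchIdeator3.lean`, checked `↔` the crux's hypothesis pair by triage r1-1). -/
def FoldData (M : Type) [TopologicalSpace M] [ChartedSpace (𝔼 4) M]
    (V : Fin 2 → Opens M) (N : Fin 2 → Type) [∀ i, TopologicalSpace (N i)]
    [∀ i, ChartedSpace (𝔼 4) (N i)]
    (s : ∀ i, Literature.Geometry.Kaehler.MForm (𝓡 4) (N i) ℝ 2) (S : Fin 2 → Type)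
    [∀ i, TopologicalSpace (S i)] [∀ i, ChartedSpace (𝔼 2) (S i)]
    (b : ∀ i, S i → N i) (β : ∀ i, M → N i) : Prop :=
  (Disjoint (V 0) (V 1) ∧ (∀ i, (V i : Set M).Nonempty) ∧
      IsConnected ((V 0 : Set M) ∪ (V 1 : Set M))ᶜ ∧
      (∃ (Z : Type) (_ : TopologicalSpace Z) (_ : ChartedSpace (𝔼 3) Z) (_ : IsManifold (𝓡 3) ∞ Z)
        (z : Z → M), Manifold.IsSmoothEmbedding (𝓡 3) (𝓡 4) ∞ z ∧
          Set.range z = ((V 0 : Set M) ∪ (V 1 : Set M))ᶜ)) ∧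
  (∀ i, Literature.Geometry.Kaehler.IsSmoothForm (s i) ∧ Literature.Geometry.Kaehler.IsClosedForm (s i) ∧
    (∀ x (v : TangentSpace (𝓡 4) x), v ≠ 0 → ∃ w, s i x ![v, w] ≠ 0) ∧
    Manifold.IsSmoothEmbedding (𝓡 2) (𝓡 4) ∞ (b i) ∧
    (∀ y (v : TangentSpace (𝓡 2) y), v ≠ 0 → ∃ w : TangentSpace (𝓡 2) y,
      s i (b i y) ![mfderiv (𝓡 2) (𝓡 4) (b i) y v, mfderiv (𝓡 2) (𝓡 4) (b i) y w] ≠ 0) ∧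
    (∃ U : Set M, IsOpen U ∧ closure (V i : Set M) ⊆ U ∧ ContMDiffOn (𝓡 4) (𝓡 4) ∞ (β i) U) ∧
    Set.InjOn (β i) (V i : Set M) ∧ β i '' (V i : Set M) = (Set.range (b i))ᶜ ∧
    (∀ x ∈ (V i : Set M), Function.Bijective (mfderiv (𝓡 4) (𝓡 4) (β i) x)) ∧
    β i '' frontier (V i : Set M) ⊆ Set.range (b i) ∧
    (∀ x ∈ frontier (V i : Set M),
      Module.finrank ℝ (LinearMap.ker (mfderiv (𝓡 4) (𝓡 4) (β i) x).toLinearMap) = 1))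

/-- **Meridian order** of a subset `B ⊂ N` (intended: a closed connected surface in a closed
4-manifold): the order of the kernel of `H₁(N ∖ B; ℤ) → H₁(N; ℤ)` (inclusion-induced, tree functor
`singularHomology.map`), i.e. of the subgroup generated by the meridian of `B`; `0` if that kernel
is infinite.  By the Thom sequence `H₂(N) →(·B) ℤ → H₁(N ∖ B) → H₁(N) → 0` it is the positive
generator of the ideal `{x · B | x ∈ H₂(N)} ⊆ ℤ` whenever that ideal is non-zero — for `b₂(N) = 1`
with an odd unimodular lattice `ℤh`, the divisibility `m` of `[B] = m h`. -/
def meridianOrder (N : Type) [TopologicalSpace N] (B : Set N) : ℕ :=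
  Nat.card (LinearMap.ker
    (Literature.AlgebraicTopology.SingularHomology.singularHomology.map ℤ ℤ
      (⟨Subtype.val, continuous_subtype_val⟩ : C(↥Bᶜ, N)) 1).hom)

/-! ### The algebra of the pinch (PROVED — this is the idea, kernel-checked) -/

/-- **(T) Rank-one integrality pinch, group-theoretic core.**  If an additive group `T` that is
cyclic of order `m₀² = m₁²` receives an injection from `ℤ/m₀ ⊕ ℤ/m₁` (`0 < mᵢ`), then
`m₀ = m₁ = 1`.  In the line: `T = Tors H₁(Z) ≅ ℤ/e`, `e = Bᵢ·Bᵢ = mᵢ²`, and the two summands are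
the meridian subgroups of `H₁(V̄₀) ⊕ H₁(V̄₁) ≅ H₁(Z)` (integral Mayer–Vietoris in the homology
sphere).  Generalises the disprover's `Negative.conic_case_excluded` (`m = 2`) and triage r1-1's
`no_double_in_cyclic`. [folklore] -/
theorem meridian_pinch {T : Type*} [AddCommGroup T] {m₀ m₁ : ℕ} (h₀ : 0 < m₀) (h₁ : 0 < m₁)
    (hc₀ : Nat.card T = m₀ ^ 2) (hc₁ : Nat.card T = m₁ ^ 2) (hT : IsAddCyclic T)
    (f : ZMod m₀ × ZMod m₁ →+ T) (hf : Function.Injective f) : m₀ = 1 ∧ m₁ = 1 := by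
  have hmm : m₀ = m₁ := by
    have h : m₀ ^ 2 = m₁ ^ 2 := hc₀.symm.trans hc₁
    exact Nat.pow_left_injective (by norm_num) h
  subst hmm
  haveI := hT
  haveI : IsAddCyclic (ZMod m₀ × ZMod m₀) := isAddCyclic_of_injective f hf
  -- a cyclic group has exponent = order (`m₀²`), but `ℤ/m₀ ⊕ ℤ/m₀` is killed by `m₀`
  have hexp : AddMonoid.exponent (ZMod m₀ × ZMod m₀) = m₀ * m₀ := by
    rw [IsAddCyclic.exponent_eq_card, Nat.card_prod, Nat.card_zmod]
  have hdvd : AddMonoid.exponent (ZMod m₀ × ZMod m₀) ∣ m₀ := by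
    refine AddMonoid.exponent_dvd_of_forall_nsmul_eq_zero fun x => ?_
    ext <;> simp [nsmul_eq_mul]
  rw [hexp] at hdvd
  have hle : m₀ * m₀ ≤ m₀ * 1 := by simpa using Nat.le_of_dvd h₀ hdvd
  have h1 : m₀ = 1 := by
    have := Nat.le_of_mul_le_mul_left hle h₀
    omega
  exact ⟨h1, h1⟩

/-- **(A) The sieve, arithmetic core** (with `e = m = 1` already pinned by (T)): adjunction
`2g − 2 = 1 − kᵢ` and `kᵢ² = 9 − 4 b₁(Nᵢ)` give `b₁(Nᵢ) = g(3 − g)` on BOTH pieces, and the pinch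
`b₁(N₀) + b₁(N₁) = 2g` leaves `g = 0` (both `b₁ = 0`) or `g = 2` (both `b₁ = 2`): `g = 1` dies
(`2 + 2 ≠ 2`), `g = 3` dies (`0 + 0 ≠ 6`), `b₁ = 4` never arises (`9 − 16` is no square).
[folklore] -/
theorem sieve {g b₀ b₁ k₀ k₁ : ℤ} (hk₀ : k₀ ^ 2 = 9 - 4 * b₀) (hk₁ : k₁ ^ 2 = 9 - 4 * b₁)
    (ha₀ : 2 * g - 2 = 1 - k₀) (ha₁ : 2 * g - 2 = 1 - k₁) (hsum : b₀ + b₁ = 2 * g) :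
    (g = 0 ∧ b₀ = 0 ∧ b₁ = 0) ∨ (g = 2 ∧ b₀ = 2 ∧ b₁ = 2) := by
  have hk₀' : k₀ = 3 - 2 * g := by linarith
  have hk₁' : k₁ = 3 - 2 * g := by linarith
  subst hk₀' hk₁'
  have hb₀ : b₀ = 3 * g - g ^ 2 := by nlinarith [hk₀]
  have hb₁ : b₁ = 3 * g - g ^ 2 := by nlinarith [hk₁]
  have hg : g * (g - 2) = 0 := by nlinarith [hb₀, hb₁, hsum]
  rcases mul_eq_zero.mp hg with h | h
  · left
    subst h
    norm_num at hb₀ hb₁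
    exact ⟨rfl, hb₀, hb₁⟩
  · right
    have h2 : g = 2 := by linarith
    subst h2
    norm_num at hb₀ hb₁
    exact ⟨rfl, hb₀, hb₁⟩

/-- Sanity (Disproof §3 `conic_case_excluded`, embedding form): by `meridian_pinch` at `m = 2`,
`ℤ/2 ⊕ ℤ/2` does not embed in the cyclic group `ℤ/4` — the (ℂP², conic) ⊔ (ℂP², conic) fold along
`L(4,1)` is not a homology sphere. -/
example : ¬ ∃ f : ZMod 2 × ZMod 2 →+ ZMod 4, Function.Injective f := by
  rintro ⟨f, hf⟩
  have h := meridian_pinch (T := ZMod 4) (m₀ := 2) (m₁ := 2) (by norm_num) (by norm_num)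
    (by rw [Nat.card_zmod]; norm_num) (by rw [Nat.card_zmod]; norm_num) inferInstance f hf
  exact absurd h.1 (by norm_num)

/-- Sanity (Disproof §3 `door_is_solution`, TIGHTNESS respected): the door tuple
`(g, b₁, k) = (2, 2, -1)` on both pieces satisfies every hypothesis of `sieve`, so the sieve's right
branch is live and the crux's escape clause is not removable by this line's bookkeeping. -/
example : ((2 : ℤ) = 0 ∧ (2 : ℤ) = 0 ∧ (2 : ℤ) = 0) ∨ ((2 : ℤ) = 2 ∧ (2 : ℤ) = 2 ∧ (2 : ℤ) = 2) :=
  sieve (g := 2) (b₀ := 2) (b₁ := 2) (k₀ := -1) (k₁ := -1)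
    (by norm_num) (by norm_num) (by norm_num) (by norm_num) (by norm_num)

/-- Sanity (round `S⁴`, CdGP Ex. 2.3/2.6 = route item `RoundSphereIsOrigamiFold`): the line/line
tuple `(g, b₁, k) = (0, 0, 3)` satisfies the hypotheses of `sieve` (left branch live). -/
example : ((0 : ℤ) = 0 ∧ (0 : ℤ) = 0 ∧ (0 : ℤ) = 0) ∨ ((0 : ℤ) = 2 ∧ (0 : ℤ) = 2 ∧ (0 : ℤ) = 2) :=
  sieve (g := 0) (b₀ := 0) (b₁ := 0) (k₀ := 3) (k₁ := 3)
    (by norm_num) (by norm_num) (by norm_num) (by norm_num) (by norm_num)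

/-! ### The four stub STATEMENTS (named `Prop`s; the registered `stub_*` theorems below restate them
verbatim, and `Registered.stub_*` are their name-keyed aliases used as hypotheses of `OrigamiRung_of`
— the skeleton audit admits hypotheses BY NAME; same device as
`Cruxes/OrigamiFoldExistence/Lines/round-trace-continuity.lean`) -/

/-- Statement of STUB S2a [Betti pinch]. -/
def BettiPinch : Prop :=
  ∀ (M : Type) [TopologicalSpace M] [T2Space M] [SecondCountableTopology M]
    [ChartedSpace (𝔼 4) M] [IsManifold (𝓡 4) ∞ M],
    M ≃ₕ 𝕊⁴ →
    ∀ (V : Fin 2 → Opens M) (N : Fin 2 → Type) [∀ i, TopologicalSpace (N i)]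
      [∀ i, T2Space (N i)] [∀ i, SecondCountableTopology (N i)] [∀ i, CompactSpace (N i)]
      [∀ i, ConnectedSpace (N i)] [∀ i, ChartedSpace (𝔼 4) (N i)] [∀ i, IsManifold (𝓡 4) ∞ (N i)]
      (s : ∀ i, Literature.Geometry.Kaehler.MForm (𝓡 4) (N i) ℝ 2) (S : Fin 2 → Type)
      [∀ i, TopologicalSpace (S i)] [∀ i, CompactSpace (S i)] [∀ i, ConnectedSpace (S i)]
      [∀ i, ChartedSpace (𝔼 2) (S i)] [∀ i, IsManifold (𝓡 2) ∞ (S i)]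
      (b : ∀ i, S i → N i) (β : ∀ i, M → N i),
      FoldData M V N s S b β →
      ∃ g : ℕ, (∀ i, Module.finrank ℤ (singularHomologyZ (S i) 1) = 2 * g ∧
          Module.finrank ℤ (singularHomologyZ (N i) 2) = 1) ∧
        Module.finrank ℤ (singularHomologyZ ↥((V 0 : Set M) ∪ (V 1 : Set M))ᶜ 1) = 2 * g ∧
        Module.finrank ℤ (singularHomologyZ (N 0) 1) + Module.finrank ℤ (singularHomologyZ (N 1) 1)
          = 2 * g

/-- Statement of STUB S2b [torsion pinch]. -/
def TorsionPinch : Prop :=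
  ∀ (M : Type) [TopologicalSpace M] [T2Space M] [SecondCountableTopology M]
    [ChartedSpace (𝔼 4) M] [IsManifold (𝓡 4) ∞ M],
    M ≃ₕ 𝕊⁴ →
    ∀ (V : Fin 2 → Opens M) (N : Fin 2 → Type) [∀ i, TopologicalSpace (N i)]
      [∀ i, T2Space (N i)] [∀ i, SecondCountableTopology (N i)] [∀ i, CompactSpace (N i)]
      [∀ i, ConnectedSpace (N i)] [∀ i, ChartedSpace (𝔼 4) (N i)] [∀ i, IsManifold (𝓡 4) ∞ (N i)]
      (s : ∀ i, Literature.Geometry.Kaehler.MForm (𝓡 4) (N i) ℝ 2) (S : Fin 2 → Type)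
      [∀ i, TopologicalSpace (S i)] [∀ i, CompactSpace (S i)] [∀ i, ConnectedSpace (S i)]
      [∀ i, ChartedSpace (𝔼 2) (S i)] [∀ i, IsManifold (𝓡 2) ∞ (S i)]
      (b : ∀ i, S i → N i) (β : ∀ i, M → N i),
      FoldData M V N s S b β →
      (∀ i, Module.finrank ℤ (singularHomologyZ (N i) 2) = 1) →
      (∀ i, 0 < meridianOrder (N i) (Set.range (b i)) ∧
          Nat.card (AddCommGroup.torsion (singularHomologyZ ↥((V 0 : Set M) ∪ (V 1 : Set M))ᶜ 1))
            = meridianOrder (N i) (Set.range (b i)) ^ 2) ∧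
      IsAddCyclic (AddCommGroup.torsion (singularHomologyZ ↥((V 0 : Set M) ∪ (V 1 : Set M))ᶜ 1)) ∧
      (∃ f : ZMod (meridianOrder (N 0) (Set.range (b 0))) × ZMod (meridianOrder (N 1) (Set.range (b 1)))
          →+ AddCommGroup.torsion (singularHomologyZ ↥((V 0 : Set M) ∪ (V 1 : Set M))ᶜ 1),
        Function.Injective f) ∧
      (∀ i, Module.finrank ℤ (singularHomologyZ (S i) 1) = 0 →
        meridianOrder (N i) (Set.range (b i)) = 1 →
          SimplyConnectedSpace (V i) ∧ ∀ k, 1 ≤ k → Limits.IsZero (singularHomologyZ (V i) k))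

/-- Statement of STUB S4 [Chern package] (one closed symplectic 4-manifold with `b₂ = 1` and one
symplectic surface in it; no fold, no `M`). -/
def ChernPackage : Prop :=
  ∀ (N : Type) [TopologicalSpace N] [T2Space N] [SecondCountableTopology N] [CompactSpace N]
    [ConnectedSpace N] [ChartedSpace (𝔼 4) N] [IsManifold (𝓡 4) ∞ N]
    (s : Literature.Geometry.Kaehler.MForm (𝓡 4) N ℝ 2)
    (S : Type) [TopologicalSpace S] [CompactSpace S] [ConnectedSpace S] [ChartedSpace (𝔼 2) S]
    [IsManifold (𝓡 2) ∞ S] (b : S → N),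
    Literature.Geometry.Kaehler.IsSmoothForm s → Literature.Geometry.Kaehler.IsClosedForm s →
    (∀ x (v : TangentSpace (𝓡 4) x), v ≠ 0 → ∃ w, s x ![v, w] ≠ 0) →
    Manifold.IsSmoothEmbedding (𝓡 2) (𝓡 4) ∞ b →
    (∀ y (v : TangentSpace (𝓡 2) y), v ≠ 0 → ∃ w : TangentSpace (𝓡 2) y,
      s (b y) ![mfderiv (𝓡 2) (𝓡 4) b y v, mfderiv (𝓡 2) (𝓡 4) b y w] ≠ 0) →
    Module.finrank ℤ (singularHomologyZ N 2) = 1 →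
    ∃ k : ℤ, k ^ 2 = 9 - 4 * (Module.finrank ℤ (singularHomologyZ N 1) : ℤ) ∧
      (Module.finrank ℤ (singularHomologyZ S 1) : ℤ) - 2
        = (meridianOrder N (Set.range b) : ℤ) ^ 2 - k * (meridianOrder N (Set.range b) : ℤ)

/-- Statement of STUB S6 [genus-zero endgame] (conditional BY STATEMENT on the tree's named fact
`gromov_recognitionR4_relEnd`, which `OrigamiRung_of` supplies from route SymplecticCap's item). -/
def GenusZeroEndgame : Prop :=
  Literature.Geometry.Symplectic.gromov_recognitionR4_relEnd →
  ∀ (M : Type) [TopologicalSpace M] [T2Space M] [SecondCountableTopology M]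
    [ChartedSpace (𝔼 4) M] [IsManifold (𝓡 4) ∞ M],
    M ≃ₕ 𝕊⁴ →
    ∀ (V : Fin 2 → Opens M) (N : Fin 2 → Type) [∀ i, TopologicalSpace (N i)]
      [∀ i, T2Space (N i)] [∀ i, SecondCountableTopology (N i)] [∀ i, CompactSpace (N i)]
      [∀ i, ConnectedSpace (N i)] [∀ i, ChartedSpace (𝔼 4) (N i)] [∀ i, IsManifold (𝓡 4) ∞ (N i)]
      (s : ∀ i, Literature.Geometry.Kaehler.MForm (𝓡 4) (N i) ℝ 2) (S : Fin 2 → Type)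
      [∀ i, TopologicalSpace (S i)] [∀ i, CompactSpace (S i)] [∀ i, ConnectedSpace (S i)]
      [∀ i, ChartedSpace (𝔼 2) (S i)] [∀ i, IsManifold (𝓡 2) ∞ (S i)]
      (b : ∀ i, S i → N i) (β : ∀ i, M → N i),
      FoldData M V N s S b β →
      (∀ i, Module.finrank ℤ (singularHomologyZ (S i) 1) = 0 ∧
          Module.finrank ℤ (singularHomologyZ (N i) 2) = 1 ∧
          meridianOrder (N i) (Set.range (b i)) = 1 ∧
          SimplyConnectedSpace (V i) ∧ ∀ k, 1 ≤ k → Limits.IsZero (singularHomologyZ (V i) k)) →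
      ∃ φ : 𝕊³ ≃ₘ⟮𝓡 3, 𝓡 3⟯ 𝕊³, IsTwistedSphere 3 φ M

/-! ### The registered stubs -/

/-- STUB S2a [BETTI PINCH] (rational pinch; M/L mathematically, XL formally until Mayer–Vietoris,
Thom isomorphism and Poincaré duality are available for `singularHomologyZ` — partly in tree:
`Literature.AlgebraicTopology.SingularHomology.{MayerVietorisExactness, ExcisionMayerVietoris,
PoincareDuality, LefschetzDuality, GysinMap, …}`).  For fold data on a homotopy 4-sphere: both
collapsed folds `Sᵢ` are closed ORIENTABLE surfaces of one genus `g` (oriented by `bᵢ* sᵢ`;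
`rank H₁(Z) = 2gᵢ + [eᵢ = 0]` for both `i`), both pieces have `b₂(Nᵢ) = 1`, `b₁(Z) = 2g` (i.e. the
Euler number `e` of `Z → Bᵢ` is non-zero) and `b₁(N₀) + b₁(N₁) = 2g`.  Proof plan (card + Disproof
`bettiPinch`/`no_isotropic_pinch`): `Xᵢ := closure (V i) = V i ∪ Z` is a compact smooth domain with
boundary `Z` (frontier `V i = Z`, Disproof §4), `V i ↪ Xᵢ` a homotopy equivalence (intrinsic collar
of `∂Xᵢ`), `V i ≅ Nᵢ ∖ Bᵢ` by `βᵢ` (`InjOn`, `β '' V = (range b)ᶜ`, bijective `mfderiv`);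
Mayer–Vietoris for `M = X₀ ∪_Z X₁` with `H₁(M) = H₂(M) = H₃(M) = 0` ⇒ `bₖ(Z) = bₖ(X₀) + bₖ(X₁)`
(`k = 1, 2`), `H₃(Xᵢ) = 0`; `Z ~ S(νBᵢ)` homologically (homology cobordism `Xᵢ ∖ β⁻¹(N ∖ ν°B)`, no
corank-1 needed); pair sequence of `(Nᵢ, Nᵢ ∖ Bᵢ)` + Thom iso ⇒ `b₁(Nᵢ ∖ Bᵢ) = b₁(Nᵢ)`
(`[Bᵢ]·[sᵢ] > 0` ⇒ `[Bᵢ]` non-torsion with non-zero pairing); χ-additivity ⇒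
`χ(N₀) + χ(N₁) = 2 + 2(2 − 2g)`; `[sᵢ]² > 0` ⇒ `b₂(Nᵢ) ≥ 1`; the `e = 0` branch forces
`b₂(Nᵢ) = 2`, `b⁺ = b⁻ = 1`, `b₁(Nᵢ)` even by `χ + σ ≡ 0 (mod 4)` for closed almost-complex
4-manifolds (McDuffSalamon2017 §13.3 p. 527), against `Σ b₁ = 2g + 1` — dead; `e ≠ 0` ⇒
`b₂ = 1` on both sides, `Σ b₁ = 2g`.  Uses from `FoldData`: the global clause, `InjOn`/image/
bijective-`mfderiv` of `βᵢ`, nondegeneracy + closedness of `sᵢ`, symplecticity + embedding of `bᵢ`;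
NOT the three blow-down clauses (`ContMDiffOn` on `U`, `β '' frontier ⊆ B`, corank 1).  Why it might
fail: only by mis-typing — e.g. `Module.finrank ℤ` is the free rank (torsion ignored, intended).
Cheapest falsifier: the round fold of `S⁴` (`g = 0`, pieces `ℂP²`: `(0,1)`, `b₁(S³) = 0` ✓) and the
door tuple (`g = 2`, `(2,1)`, `b₁(Z) = 4` ✓).  Sources: HatcherAT2002 §2.2, §3.3; MilnorStasheff1974
(Thom/Gysin); McDuffSalamon2017 §13.3; GompfStipsicz1999 §1.4; card rank-one-integrality-pinch;
Disproof §3–4.  Size: L. -/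
theorem stub_bettiPinch :
    ∀ (M : Type) [TopologicalSpace M] [T2Space M] [SecondCountableTopology M]
      [ChartedSpace (𝔼 4) M] [IsManifold (𝓡 4) ∞ M],
      M ≃ₕ 𝕊⁴ →
      ∀ (V : Fin 2 → Opens M) (N : Fin 2 → Type) [∀ i, TopologicalSpace (N i)]
        [∀ i, T2Space (N i)] [∀ i, SecondCountableTopology (N i)] [∀ i, CompactSpace (N i)]
        [∀ i, ConnectedSpace (N i)] [∀ i, ChartedSpace (𝔼 4) (N i)] [∀ i, IsManifold (𝓡 4) ∞ (N i)]
        (s : ∀ i, Literature.Geometry.Kaehler.MForm (𝓡 4) (N i) ℝ 2) (S : Fin 2 → Type)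
        [∀ i, TopologicalSpace (S i)] [∀ i, CompactSpace (S i)] [∀ i, ConnectedSpace (S i)]
        [∀ i, ChartedSpace (𝔼 2) (S i)] [∀ i, IsManifold (𝓡 2) ∞ (S i)]
        (b : ∀ i, S i → N i) (β : ∀ i, M → N i),
        FoldData M V N s S b β →
        ∃ g : ℕ, (∀ i, Module.finrank ℤ (singularHomologyZ (S i) 1) = 2 * g ∧
            Module.finrank ℤ (singularHomologyZ (N i) 2) = 1) ∧
          Module.finrank ℤ (singularHomologyZ ↥((V 0 : Set M) ∪ (V 1 : Set M))ᶜ 1) = 2 * g ∧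
          Module.finrank ℤ (singularHomologyZ (N 0) 1) + Module.finrank ℤ (singularHomologyZ (N 1) 1)
            = 2 * g := by
  sorry

/-- STUB S2b [TORSION PINCH] (integral pinch — the topological half of lever (T); M/L mathematically,
XL formally).  Given `b₂(Nᵢ) = 1` (from S2a): the intersection lattice of each piece is `ℤh` with
`h² = ±1`, `= +1` since `[sᵢ]² > 0`; `[Bᵢ] = mᵢ h + torsion` with `mᵢ > 0` (`[Bᵢ]·[sᵢ] > 0`), and by
the Thom sequence `H₂(Nᵢ) →(·Bᵢ) ℤ → H₁(Nᵢ ∖ Bᵢ) → H₁(Nᵢ) → 0` the meridian kernel is `ℤ/mᵢ`, so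
`meridianOrder = mᵢ > 0`; `Z ~ S(νBᵢ)` (homology cobordism, as in S2a) with Euler number
`eᵢ = Bᵢ·Bᵢ = mᵢ²`, Gysin ⇒ `H₁(Z) ≅ ℤ^{2g} ⊕ ℤ/mᵢ²`: torsion CYCLIC of order `mᵢ²` for BOTH `i`;
the INTEGRAL Mayer–Vietoris isomorphism `H₁(Z) ≅ H₁(X₀) ⊕ H₁(X₁)` (`H₂(M) = H₁(M) = 0`) carries the
two meridian subgroups `ℤ/m₀ ⊂ H₁(X₀)`, `ℤ/m₁ ⊂ H₁(X₁)` to an embedded `ℤ/m₀ ⊕ ℤ/m₁ ⊂ Tors H₁(Z)`.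
Genus-0 export (triage sharpen r1-2/3: "export `e = 1` / `H̃_*(V i) = 0` / `Z ≅ S³`"): if
`b₁(Sᵢ) = 0` (so `Bᵢ ≅ S²`, orientable) and `mᵢ = 1` (so `e = 1`), then `Z ≅ S(O(1) → S²) = S³`,
hence `H̃_*(Xᵢ) = 0` (MV) and `π₁(Xᵢ) = 1` (van Kampen: `1 = π₁(M) = π₁(X₀) * π₁(X₁)`), and the
same for `V i ≃ Xᵢ`.  Uses the same `FoldData` clauses as S2a (no blow-down clause).  Why it might
fail: mis-typing only (`Nat.card` of an infinite kernel is `0` — excluded by `0 < mᵢ`, asserted).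
Cheapest falsifier: conic in `ℂP²` (`m = 2`: `H₁(ℂP² ∖ conic) = ℤ/2` ✓, `Tors H₁(L(4,1)) = ℤ/4` ✓,
and a conic double is correctly NOT a homology sphere: `meridian_pinch`); line (`m = 1`, `Z = S³`,
`V = B⁴` contractible ✓).  Sources: HatcherAT2002 §2.2, §3.3, Ex. 4.D; MilnorStasheff1974 §12
(Gysin/Thom); Hantzsche1938 (doi:10.1007/bf01181085, the `T ⊕ T` form); GompfStipsicz1999 §1.4
(meridians, normal circle bundles); cards rank-one-integrality-pinch, torus-meridian-pinch,
adjunction-doubling-sieve; triage r1-1 `no_double_in_cyclic`.  Size: L. -/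
theorem stub_torsionPinch :
    ∀ (M : Type) [TopologicalSpace M] [T2Space M] [SecondCountableTopology M]
      [ChartedSpace (𝔼 4) M] [IsManifold (𝓡 4) ∞ M],
      M ≃ₕ 𝕊⁴ →
      ∀ (V : Fin 2 → Opens M) (N : Fin 2 → Type) [∀ i, TopologicalSpace (N i)]
        [∀ i, T2Space (N i)] [∀ i, SecondCountableTopology (N i)] [∀ i, CompactSpace (N i)]
        [∀ i, ConnectedSpace (N i)] [∀ i, ChartedSpace (𝔼 4) (N i)] [∀ i, IsManifold (𝓡 4) ∞ (N i)]
        (s : ∀ i, Literature.Geometry.Kaehler.MForm (𝓡 4) (N i) ℝ 2) (S : Fin 2 → Type)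
        [∀ i, TopologicalSpace (S i)] [∀ i, CompactSpace (S i)] [∀ i, ConnectedSpace (S i)]
        [∀ i, ChartedSpace (𝔼 2) (S i)] [∀ i, IsManifold (𝓡 2) ∞ (S i)]
        (b : ∀ i, S i → N i) (β : ∀ i, M → N i),
        FoldData M V N s S b β →
        (∀ i, Module.finrank ℤ (singularHomologyZ (N i) 2) = 1) →
        (∀ i, 0 < meridianOrder (N i) (Set.range (b i)) ∧
            Nat.card (AddCommGroup.torsion (singularHomologyZ ↥((V 0 : Set M) ∪ (V 1 : Set M))ᶜ 1))
              = meridianOrder (N i) (Set.range (b i)) ^ 2) ∧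
        IsAddCyclic (AddCommGroup.torsion (singularHomologyZ ↥((V 0 : Set M) ∪ (V 1 : Set M))ᶜ 1)) ∧
        (∃ f : ZMod (meridianOrder (N 0) (Set.range (b 0))) × ZMod (meridianOrder (N 1) (Set.range (b 1)))
            →+ AddCommGroup.torsion (singularHomologyZ ↥((V 0 : Set M) ∪ (V 1 : Set M))ᶜ 1),
          Function.Injective f) ∧
        (∀ i, Module.finrank ℤ (singularHomologyZ (S i) 1) = 0 →
          meridianOrder (N i) (Set.range (b i)) = 1 →
            SimplyConnectedSpace (V i) ∧
              ∀ k, 1 ≤ k → Limits.IsZero (singularHomologyZ (V i) k)) := by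
  sorry

/-- STUB S4 [CHERN PACKAGE] (the one classical characteristic-class package of the line; L
mathematically, XL formally: `c₁` of almost-complex manifolds and the signature theorem are not in
Mathlib — a prover may vendor the two printed identities as cite facts).  For a closed connected
symplectic 4-manifold `(N, s)` with `b₂(N) = 1` and a closed connected `s`-symplectic embedded
surface `B = b(S)`: the lattice `H₂(N)/Tors = ℤh` is unimodular with `[s]² > 0`, so `h² = +1`,
`b⁺ = 1`, `σ = 1`, `χ = 2 − 2b₁ + b₂ = 3 − 2b₁`; choose an `s`-tame almost complex structure `J`
with `B` `J`-holomorphic (B symplectic ⇒ possible, McDuffSalamon2017 §2.6 / Wendl2018 §2.1); write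
`c₁(TN, J) ≡ k h`, `[B] ≡ m h` mod torsion with `m > 0` (`∫_B s > 0`; `h` oriented accordingly).
Then `k² = c₁² = 2χ + 3σ = 9 − 4b₁` (Hirzebruch signature theorem + Wu: McDuffSalamon2017 (4.1.7)
p. 161 / Rem. 4.1.10; GompfStipsicz1999 Thm 1.4.15) and adjunction `2g − 2 = B·B − c₁·B = m² − km`
(McDuffSalamon2017 Ex. 4.4.5, (4.4.5) p. 185 "continues to hold in the almost complex case";
GompfStipsicz1999 §1.4); `b₁(S) = 2g` (S oriented by `b* s`); and `m = meridianOrder N (range b)`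
by the Thom sequence `H₂(N) →(·B) ℤ → H₁(N ∖ B) → H₁(N) → 0` (image `m·(h·H₂(N)) = mℤ` since
`h·h = 1`).  Why it might fail: only through conventions — both signs of `k` are allowed (∃ k), the
orientation is the symplectic one inside the proof, torsion in `H₂` is quotiented out; `finrank`
counts free rank.  NOT used: any Seiberg–Witten / Gromov–Taubes input, minimality, Kodaira
dimension.  Cheapest falsifier: (ℂP², line): `b₁ = 0`, `k = 3`, `m = 1`, `g = 0`: `-2 = 1 - 3` ✓;
(ℂP², conic): `m = 2`: `-2 = 4 - 6` ✓; cubic: `m = 3`, `g = 1`: `0 = 9 - 9` ✓; door `(b₁, k, m, g)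
= (2, ±1, 1, 2)`: `2 = 1 + 1` with `k = -1` ✓ (`Negative.door_is_solution`).  Sources:
McDuffSalamon2017 (4.1.7), Rem 4.1.10, Ex 4.4.5, §13.3; GompfStipsicz1999 §1.4; Wendl2018 §2.1;
MilnorStasheff1974; HirzebruchSignature (Hirzebruch1956).  Size: L (XL formal). -/
theorem stub_chernPackage :
    ∀ (N : Type) [TopologicalSpace N] [T2Space N] [SecondCountableTopology N] [CompactSpace N]
      [ConnectedSpace N] [ChartedSpace (𝔼 4) N] [IsManifold (𝓡 4) ∞ N]
      (s : Literature.Geometry.Kaehler.MForm (𝓡 4) N ℝ 2)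
      (S : Type) [TopologicalSpace S] [CompactSpace S] [ConnectedSpace S] [ChartedSpace (𝔼 2) S]
      [IsManifold (𝓡 2) ∞ S] (b : S → N),
      Literature.Geometry.Kaehler.IsSmoothForm s → Literature.Geometry.Kaehler.IsClosedForm s →
      (∀ x (v : TangentSpace (𝓡 4) x), v ≠ 0 → ∃ w, s x ![v, w] ≠ 0) →
      Manifold.IsSmoothEmbedding (𝓡 2) (𝓡 4) ∞ b →
      (∀ y (v : TangentSpace (𝓡 2) y), v ≠ 0 → ∃ w : TangentSpace (𝓡 2) y,
        s (b y) ![mfderiv (𝓡 2) (𝓡 4) b y v, mfderiv (𝓡 2) (𝓡 4) b y w] ≠ 0) →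
      Module.finrank ℤ (singularHomologyZ N 2) = 1 →
      ∃ k : ℤ, k ^ 2 = 9 - 4 * (Module.finrank ℤ (singularHomologyZ N 1) : ℤ) ∧
        (Module.finrank ℤ (singularHomologyZ S 1) : ℤ) - 2
          = (meridianOrder N (Set.range b) : ℤ) ^ 2 - k * (meridianOrder N (Set.range b) : ℤ) := by
  sorry

/-- STUB S6 [GENUS-ZERO ENDGAME] — HARDEST (the load-bearing construction of the line; XL).
Under Gromov's recognition of `(ℝ⁴, ω₀)` relative at infinity (the tree's named fact
`Literature.Geometry.Symplectic.gromov_recognitionR4_relEnd`, McDuffSalamon2017 Rem 4.5.2 (viii) —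
taken as the ANTECEDENT, supplied by name in `OrigamiRung_of` from route SymplecticCap's crux
`GromovRecognitionRelEnd`, stmt-SmoothPoincare4-11009): fold data on a homotopy 4-sphere whose
pieces carry the genus-0 export of S2a/S2b (`b₁(Sᵢ) = 0`, `b₂(Nᵢ) = 1`, meridian order `1`,
`V i` simply connected and acyclic) make `M` a twisted sphere `D⁴ ∪_φ D⁴`.  Proof plan (cards
pair-rigidity-endgame / stretch-to-gromov / cap-swap-gromov-end + round-tube-pullback-collar):
(1) `Sᵢ` is a closed orientable (by `bᵢ* sᵢ`) surface with `b₁ = 0`, hence `≅ S²`; `[Bᵢ]` is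
primitive (meridian order 1) in the `⟨+1⟩` lattice, so `Bᵢ·Bᵢ = +1` and `Nᵢ` is minimal (`b⁻ = 0`).
(2) Symplectic neighbourhood theorem (McDuffSalamon2017 Thm 3.4.10) for the `(+1)`-sphere `Bᵢ`
+ `ℂP² ∖ ℂP¹ =` open ball (ibid. Ex 7.1.16): a punctured neighbourhood of `Bᵢ` in `(Nᵢ, sᵢ)`, i.e.
the END of `(V i, βᵢ* sᵢ)`, is symplectomorphic to an OUTER shell `{R₁ < |z| < R₀} ⊂ (ℝ⁴, ω₀)`,
`|z| ↑ R₀` at `Z`.  (3) Cap/stretch: glue `{|z| ≥ R₀}` on (or stretch the form radially) to get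
`V̂ᵢ ⊇ V i`, symplectic, standard at infinity, with `V̂ᵢ ≃ V i` contractible by the export
(`π₁ = 1`, `H̃_* = 0`, Whitehead), so `π₂(V̂ᵢ) = 0`; the antecedent gives `Φ : V̂ᵢ ≅ ℝ⁴` equal to
the end chart off a compact set, whence `V i ∪ {|z| = R₀}` is a smooth closed 4-BALL (complement in
`S⁴ = ℝ⁴ ∪ ∞` of the standard cap ball; Palais disc theorem, in tree as `BallGluingUniqueness` /
`nonempty_diffeomorph_of_isBoundaryGluing`).  (4) COLLAR LEMMA (the crux's typed-data risk; corank
1 used HERE): `rank dβᵢ = 3 = 2 + 1` over the surface forces `ker dβᵢ ⊂ TZ` and a transverse normal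
jet; with `βᵢ` smooth on `U ⊇ closure (V i)`, Hadamard gives `w ∘ βᵢ = t·u`, `u ≠ 0`, so the signed
`ρᵢ = t|u|` (= the shell radius `R₀ − |z|` read through `βᵢ`, up to a diffeomorphism of `[0, ε)`) is
a boundary-defining function of `Z` in `Xᵢ = closure (V i)` without critical points near `Z`
(Disproof §4 `collarLemmaSketch`; cards round-tube-pullback-collar, corank-one-collar); hence
`Xᵢ ≅ V i ∪ {|z| = R₀} ≅ D⁴` compatibly with `Z`, and `Z ≅ S³`.  (5) `M = X₀ ∪_Z X₁`, two smoothly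
embedded closed 4-balls meeting exactly along their boundary spheres: `IsTwistedSphere 3 φ M` with
`φ` the composite boundary identification (tree: `IsBoundaryGluing`, `closedBallBoundaryData`,
`BlendCollars`, `CollarAttachment`); `φ` is ARBITRARY (the two null fibrations of `Z` induced by
`β₀`, `β₁` need not agree — Disproof §4), which is why Cerf is needed downstream.  ALTERNATIVE
ENGINE E1 (ignore the antecedent): Wendl2018 Thm D(2) = McDuff1990 Thm 1.4 + Cor 1.5(i) on the
PAIR `(Nᵢ, Bᵢ)` (closed minimal + symplectic `(+1)`-sphere ⇒ `(Nᵢ, Bᵢ) ≅ (ℂP², line)`), then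
`Nᵢ ∖ ν°Bᵢ = D⁴` and (4)–(5).  DO NOT stub "`β̃ᵢ : Xᵢ → Bl_{Bᵢ} Nᵢ` is a diffeomorphism" (false as
typed: triage r1-2/3 counter-model `β = t e^{i(φ₀(θ)+tφ₁(θ))}`); only the level-set collar is true.
Why it might fail: the statement cannot, short of an exotic `S⁴` (Disproof §1); the proof can stall
on (2)–(3) needing the RELATIVE clause of Gromov's theorem exactly as vendored (checked verbatim by
triage r1-2/3) and on the formal cost of Weinstein neighbourhoods / gluing charts (tree has
`GromovR4RelEnd.chartForm`, `StandardEnd`, `Gluing`, `ClosedBall`, collar files).  Barriers: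
GluckTwistCP2Barrier is evaded because the PAIR `(Nᵢ, Bᵢ)`/the complement `V i ⊂ M` is used, never
`Nᵢ ≅ ℂP²` alone; OpenAnalogue/Contractible barriers: `D⁴` comes from the relative clause / pair
theorem, never from "interior ≅ ℝ⁴" or contractibility.  Sources: McDuffSalamon2017 Thm 3.4.10,
Rem 4.5.2 (vi)/(viii), Ex 7.1.16; Gromov1985 §0.3.C; McDuff1990 Thm 1.4, Cor 1.5(i); Wendl2018 Thm
D(2); CannasdasilvaGuilleminPires2010 Def 2.13 (model only); Hirsch1976 §4.5–4.6, §8.2; Palais1960.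
Size: XL. -/
theorem stub_genusZeroEndgame :
    Literature.Geometry.Symplectic.gromov_recognitionR4_relEnd →
    ∀ (M : Type) [TopologicalSpace M] [T2Space M] [SecondCountableTopology M]
      [ChartedSpace (𝔼 4) M] [IsManifold (𝓡 4) ∞ M],
      M ≃ₕ 𝕊⁴ →
      ∀ (V : Fin 2 → Opens M) (N : Fin 2 → Type) [∀ i, TopologicalSpace (N i)]
        [∀ i, T2Space (N i)] [∀ i, SecondCountableTopology (N i)] [∀ i, CompactSpace (N i)]
        [∀ i, ConnectedSpace (N i)] [∀ i, ChartedSpace (𝔼 4) (N i)] [∀ i, IsManifold (𝓡 4) ∞ (N i)]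
        (s : ∀ i, Literature.Geometry.Kaehler.MForm (𝓡 4) (N i) ℝ 2) (S : Fin 2 → Type)
        [∀ i, TopologicalSpace (S i)] [∀ i, CompactSpace (S i)] [∀ i, ConnectedSpace (S i)]
        [∀ i, ChartedSpace (𝔼 2) (S i)] [∀ i, IsManifold (𝓡 2) ∞ (S i)]
        (b : ∀ i, S i → N i) (β : ∀ i, M → N i),
        FoldData M V N s S b β →
        (∀ i, Module.finrank ℤ (singularHomologyZ (S i) 1) = 0 ∧
            Module.finrank ℤ (singularHomologyZ (N i) 2) = 1 ∧
            meridianOrder (N i) (Set.range (b i)) = 1 ∧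
            SimplyConnectedSpace (V i) ∧ ∀ k, 1 ≤ k → Limits.IsZero (singularHomologyZ (V i) k)) →
        ∃ φ : 𝕊³ ≃ₘ⟮𝓡 3, 𝓡 3⟯ 𝕊³, IsTwistedSphere 3 φ M := by
  sorry

/-! ### Consistency: each named statement IS its registered stub (definitionally) -/

theorem bettiPinch_holds : BettiPinch := stub_bettiPinch
theorem torsionPinch_holds : TorsionPinch := stub_torsionPinch
theorem chernPackage_holds : ChernPackage := stub_chernPackage
theorem genusZeroEndgame_holds : GenusZeroEndgame := stub_genusZeroEndgame

/-! ### Name-keyed aliases of the four statements (the hypotheses of the composition) -/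
namespace Registered

/-- Alias of `BettiPinch` keyed by the registered stub name. -/
abbrev stub_bettiPinch : Prop := BettiPinch
/-- Alias of `TorsionPinch` keyed by the registered stub name. -/
abbrev stub_torsionPinch : Prop := TorsionPinch
/-- Alias of `ChernPackage` keyed by the registered stub name. -/
abbrev stub_chernPackage : Prop := ChernPackage
/-- Alias of `GenusZeroEndgame` keyed by the registered stub name. -/
abbrev stub_genusZeroEndgame : Prop := GenusZeroEndgame

end Registered

/-! ### Glue (proved): the genus dichotomy from S2a + S2b + S4 + the algebra -/

/-- **Genus dichotomy** (the card's first lemma `GenusDichotomy`, now DERIVED): fold data on a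
homotopy 4-sphere ⇒ EITHER the genus-0 export (spheres, `b₂ = 1`, meridian order `1`, simply
connected acyclic pieces) for both `i`, OR both pieces are doors `(b₁, b₂) = (2, 1)`. -/
theorem genusDichotomy_of (h₁ : BettiPinch) (h₂ : TorsionPinch) (h₃ : ChernPackage)
    (M : Type) [TopologicalSpace M] [T2Space M] [SecondCountableTopology M]
    [ChartedSpace (𝔼 4) M] [IsManifold (𝓡 4) ∞ M] (e : M ≃ₕ 𝕊⁴)
    (V : Fin 2 → Opens M) (N : Fin 2 → Type) [∀ i, TopologicalSpace (N i)]
    [∀ i, T2Space (N i)] [∀ i, SecondCountableTopology (N i)] [∀ i, CompactSpace (N i)]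
    [∀ i, ConnectedSpace (N i)] [∀ i, ChartedSpace (𝔼 4) (N i)] [∀ i, IsManifold (𝓡 4) ∞ (N i)]
    (s : ∀ i, Literature.Geometry.Kaehler.MForm (𝓡 4) (N i) ℝ 2) (S : Fin 2 → Type)
    [∀ i, TopologicalSpace (S i)] [∀ i, CompactSpace (S i)] [∀ i, ConnectedSpace (S i)]
    [∀ i, ChartedSpace (𝔼 2) (S i)] [∀ i, IsManifold (𝓡 2) ∞ (S i)]
    (b : ∀ i, S i → N i) (β : ∀ i, M → N i) (hF : FoldData M V N s S b β) :
    (∀ i, Module.finrank ℤ (singularHomologyZ (S i) 1) = 0 ∧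
        Module.finrank ℤ (singularHomologyZ (N i) 2) = 1 ∧
        meridianOrder (N i) (Set.range (b i)) = 1 ∧
        SimplyConnectedSpace (V i) ∧ ∀ k, 1 ≤ k → Limits.IsZero (singularHomologyZ (V i) k)) ∨
    (∀ i, Module.finrank ℤ (singularHomologyZ (N i) 1) = 2 ∧
        Module.finrank ℤ (singularHomologyZ (N i) 2) = 1) := by
  -- S2a: the rational pinch
  obtain ⟨g, hSN, -, hsum⟩ := h₁ M e V N s S b β hF
  have hN2 : ∀ i, Module.finrank ℤ (singularHomologyZ (N i) 2) = 1 := fun i => (hSN i).2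
  -- S2b: the integral pinch
  obtain ⟨hm, hcyc, ⟨f, hf⟩, hexport⟩ := h₂ M e V N s S b β hF hN2
  -- S4: the Chern package on each piece
  have hch : ∀ i, ∃ k : ℤ, k ^ 2 = 9 - 4 * (Module.finrank ℤ (singularHomologyZ (N i) 1) : ℤ) ∧
      (Module.finrank ℤ (singularHomologyZ (S i) 1) : ℤ) - 2
        = (meridianOrder (N i) (Set.range (b i)) : ℤ) ^ 2
            - k * (meridianOrder (N i) (Set.range (b i)) : ℤ) :=
    fun i => h₃ (N i) (s i) (S i) (b i) (hF.2 i).1 (hF.2 i).2.1 (hF.2 i).2.2.1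
      (hF.2 i).2.2.2.1 (hF.2 i).2.2.2.2.1 (hN2 i)
  -- (T): both meridian orders are 1
  obtain ⟨hm0, hm1⟩ := meridian_pinch (hm 0).1 (hm 1).1 (hm 0).2 (hm 1).2 hcyc f hf
  have hmi : ∀ i, meridianOrder (N i) (Set.range (b i)) = 1 := by
    intro i
    fin_cases i
    · exact hm0
    · exact hm1
  -- (A): the sieve
  obtain ⟨k₀, hk₀, ha₀⟩ := hch 0
  obtain ⟨k₁, hk₁, ha₁⟩ := hch 1
  rw [hmi 0, (hSN 0).1] at ha₀
  rw [hmi 1, (hSN 1).1] at ha₁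
  push_cast at ha₀ ha₁
  have hsum' : (Module.finrank ℤ (singularHomologyZ (N 0) 1) : ℤ)
      + (Module.finrank ℤ (singularHomologyZ (N 1) 1) : ℤ) = 2 * (g : ℤ) := by
    exact_mod_cast hsum
  rcases sieve hk₀ hk₁ (by linarith) (by linarith) hsum' with ⟨hg, -, -⟩ | ⟨-, hb₀, hb₁⟩
  · -- genus 0: the export
    left
    have hg0 : g = 0 := by exact_mod_cast hg
    intro i
    have hS0 : Module.finrank ℤ (singularHomologyZ (S i) 1) = 0 := by rw [(hSN i).1, hg0]
    exact ⟨hS0, hN2 i, hmi i, (hexport i hS0 (hmi i)).1, (hexport i hS0 (hmi i)).2⟩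
  · -- genus 2: doors
    right
    intro i
    fin_cases i
    · exact ⟨by exact_mod_cast hb₀, hN2 0⟩
    · exact ⟨by exact_mod_cast hb₁, hN2 1⟩

/-! ### The composition: the four stubs and the two shared named obligations imply the crux, by name -/

/-- `OrigamiRung` from the four registered stubs and the two SHARED obligations taken by name —
route SymplecticCap's crux `GromovRecognitionRelEnd` (= the tree fact `gromov_recognitionR4_relEnd`,
`Iff.rfl`) and route SchoenfliesSplit's item `SchsplitCerf` (= the tree fact
`cerf_twistedSphere_four`, verbatim) — by pure logic plus the PROVED packaging theorem
`compactSpace_of_homotopyEquiv_sphere_four_holds`; no `sorry` here. -/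
theorem OrigamiRung_of (h₁ : Registered.stub_bettiPinch) (h₂ : Registered.stub_torsionPinch)
    (h₃ : Registered.stub_chernPackage) (h₄ : Registered.stub_genusZeroEndgame)
    (hG : Summit.SmoothPoincare4.SmoothPoincare4.Theses.SymplecticCap.GromovRecognitionRelEnd)
    (hC : Summit.SmoothPoincare4.SmoothPoincare4.Theses.SchoenfliesSplit.SchsplitCerf) :
    OrigamiRung := by
  intro M _ _ _ _ _ e V N _ _ _ _ _ _ _ s S _ _ _ _ _ b β hdata hprops
  have hF : FoldData M V N s S b β := ⟨hdata, hprops⟩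
  rcases genusDichotomy_of h₁ h₂ h₃ M e V N s S b β hF with h | h
  · -- genus 0: twisted sphere by the endgame, `S⁴` by Cerf
    have hG' : Literature.Geometry.Symplectic.gromov_recognitionR4_relEnd := hG
    obtain ⟨φ, hφ⟩ := h₄ hG' M e V N s S b β hF h
    haveI : CompactSpace M :=
      Literature.Topology.FourManifolds.compactSpace_of_homotopyEquiv_sphere_four_holds M e
    exact Or.inl (hC φ { carrier := M, isTwistedSphere := hφ })
  · exact Or.inr h

/-- Wiring check: the registered stubs feed `OrigamiRung_of` as stated. -/
example (hG : Summit.SmoothPoincare4.SmoothPoincare4.Theses.SymplecticCap.GromovRecognitionRelEnd)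
    (hC : Summit.SmoothPoincare4.SmoothPoincare4.Theses.SchoenfliesSplit.SchsplitCerf) :
    OrigamiRung :=
  OrigamiRung_of stub_bettiPinch stub_torsionPinch stub_chernPackage stub_genusZeroEndgame hG hC

end Summit.SmoothPoincare4.SmoothPoincare4.Cruxes.OrigamiRung.RankOneIntegralityPinch

end
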